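/-
Copyright (c) 2026. All rights reserved.
Released under Apache 2.0 license as described in the file LICENSE.
Authors: abc-iut cell, wave-2 seat abc-iut-L3-t10 (gen 3; proof-only toolkit, row «LD-REPAIR» (C0): the compact
overgroup `Q = lim_j G_j` of a system of FINITE discrete groups, with its kernels and universal map).
-/
import Literature.AnabelianGeometry.SemiGraphs.TemperedGroupsLimit
import HarnessLib

/-!
# Inverse limits of finite discrete groups: compactness, level kernels, the universal map

Mochizuki, *Semi-graphs of anabelioids*, Publ. RIMS **42** (2006) [MochizukiSemiAnbd2006], Prop. 3.6 (iii)
p. 38 ("the full embedding `B(G) ↪ B^temp(G)` induces an injection `π₁^temp(G) ↪ π̂₁(G)`") and the proof of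
Thm. 3.7 (iii) p. 41 with the author's *Comments* (2020) (6)(b) ("converge, in the profinite topology, … in
the profinite fundamental group `π̂₁(G)`"): the profinite `π̂₁(G) = lim_j Gal(𝒢_j/𝒢)` over a cofinal system of
finite étale Galois coverings is the COMPACT overgroup `Q` of the per-level branch dictionary
(`CovLevelDictionary`, `GaloisLevelData.compactInVerticial_of_towerDictionary`), its covering kernels
`M_j = ker (Q → Gal(𝒢_j/𝒢))` being open, normal, antitone and meeting in `1`.

PROOF-ONLY TOOLKIT over abc-iut-L3-t2's `CountableDiscreteSystem` (`TemperedGroupsLimit.lean`; an inverse system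
`S` of countable discrete groups with surjective transition maps and its limit `S.limit ≤ ∏_i S.obj i`), for the
producer of that dictionary (cell row «LD-REPAIR» (C0), seat abc-iut-L3-t10 gen 3); no definitions except the
universal homomorphism `CountableDiscreteSystem.lift`:

* `CountableDiscreteSystem.isClosed_limit` — the limit is closed in the product; hence, for FINITE `S.obj i`,
  `CountableDiscreteSystem.compactSpace_limit` (the product of finite discrete spaces is compact; a theorem, use
  `haveI`) — together with the subspace instances `T2Space`, `IsTopologicalGroup` (automatic) this is the
  "compact Hausdorff `Q`";
* the level kernels `ker (S.proj i)`: `isOpen_ker_proj`, `ker_proj_anti` (antitone in `i`),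
  `eq_one_of_forall_proj` (they meet in `1`) — the fields `isOpen_M / M_anti / M_trivial` of `CovLevelDictionary`
  for `M i := ker (S.proj i)` (normality is `MonoidHom.normal_ker`);
* `CountableDiscreteSystem.lift` — a compatible family `π_i : Γ →* S.obj i` factors through `S.limit`;
  `proj_lift`, `lift_injective` (injective iff the `ker π_i` meet in `1` — print's "residually finite", Prop. 3.6
  (iii)), `continuous_lift` (continuous when every `π_i` is, i.e. has open kernel).

Nothing here takes a side on [IUTchIII] Cor. 3.12.
-/

namespace Literature.AnabelianGeometry.SemiGraphs

namespace CountableDiscreteSystem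

open _root_.Topology

universe u

variable (S : CountableDiscreteSystem.{u})

/-! ### The limit is a closed, hence (for finite levels) compact, subgroup of the product -/

/-- The limit `lim_i S.obj i` is closed in `∏_i S.obj i` (an intersection of equalisers of continuous maps
into discrete, hence Hausdorff, spaces). [cite: MochizukiSemiAnbd2006, Prop 3.6(iii) p.38] -/
theorem isClosed_limit : IsClosed (S.limit : Set (∀ i, S.obj i)) := by
  have h : (S.limit : Set (∀ i, S.obj i)) =
      ⋂ (i : S.ι) (j : S.ι) (hij : i ≤ j), {x | S.map hij (x j) = x i} := by
    ext x
    simp only [SetLike.mem_coe, mem_limit_iff, Set.mem_iInter, Set.mem_setOf_eq]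
  rw [h]
  refine isClosed_iInter fun i => isClosed_iInter fun j => isClosed_iInter fun hij => ?_
  exact isClosed_eq ((continuous_of_discreteTopology).comp (continuous_apply j)) (continuous_apply i)

/-- **`Q = lim_i G_i` is compact** when the `G_i` are finite (closed subspace of a product of finite discrete
spaces; print: the profinite `π̂₁(G)`); stated as a theorem — consumers write `haveI := S.compactSpace_limit`.
(`T2Space S.limit` and `IsTopologicalGroup S.limit` are found by instance search: subtype of a product.)
[cite: MochizukiSemiAnbd2006, Prop 3.6(iii) p.38] -/
theorem compactSpace_limit [∀ i, Finite (S.obj i)] : CompactSpace S.limit :=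
  isCompact_iff_compactSpace.mp S.isClosed_limit.isCompact

/-- Instance-search check: the limit is a Hausdorff topological group. [cite: MochizukiSemiAnbd2006, Prop 3.6(iii) p.38] -/
example : T2Space S.limit ∧ IsTopologicalGroup S.limit := ⟨inferInstance, inferInstance⟩

/-! ### The level kernels `M_i = ker (Q → G_i)` -/

/-- The level kernels are open. [cite: MochizukiSemiAnbd2006, Prop 3.6(iii) p.38] -/
theorem isOpen_ker_proj (i : S.ι) : IsOpen ((S.proj i).ker : Set S.limit) := by
  change IsOpen ((S.proj i) ⁻¹' {1})
  exact (isOpen_discrete {(1 : S.obj i)}).preimage (S.continuous_proj i)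

/-- Pointwise compatibility in the limit. [cite: MochizukiSemiAnbd2006, Prop 3.6(iii) p.38] -/
theorem map_proj {i j : S.ι} (h : i ≤ j) (x : S.limit) : S.map h (S.proj j x) = S.proj i x := x.2 h

/-- The level kernels are antitone in the level. [cite: MochizukiSemiAnbd2006, Prop 3.6(iii) p.38] -/
theorem ker_proj_anti {i j : S.ι} (h : i ≤ j) : (S.proj j).ker ≤ (S.proj i).ker := by
  intro x hx
  rw [MonoidHom.mem_ker] at hx ⊢
  rw [← S.map_proj h, hx, map_one]

/-- The level kernels meet in `1`. [cite: MochizukiSemiAnbd2006, Prop 3.6(iii) p.38] -/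
theorem eq_one_of_forall_proj (x : S.limit) (hx : ∀ i, x ∈ (S.proj i).ker) : x = 1 :=
  Subtype.ext (funext fun i => hx i)

/-- The level kernels are directed downward (for the lemma `iInter_mul_coe_eq_of_isCompact`).
[cite: MochizukiSemiAnbd2006, Prop 3.6(iii) p.38] -/
theorem ker_proj_directed (i j : S.ι) : ∃ k, (S.proj k).ker ≤ (S.proj i).ker ∧ (S.proj k).ker ≤ (S.proj j).ker := by
  obtain ⟨k, hik, hjk⟩ := S.isDirected.directed i j
  exact ⟨k, S.ker_proj_anti hik, S.ker_proj_anti hjk⟩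

/-! ### The universal homomorphism into the limit -/

section Lift

variable {Γ : Type*} [Group Γ] (π : ∀ i : S.ι, Γ →* S.obj i)
  (hπ : ∀ ⦃i j : S.ι⦄ (h : i ≤ j) (g : Γ), S.map h (π j g) = π i g)

/-- **The universal homomorphism** `Γ → lim_i S.obj i` of a compatible family `π_i : Γ → S.obj i` (print:
`π₁^temp(G) → π̂₁(G)` from the actions on the finite étale Galois coverings). [cite: MochizukiSemiAnbd2006, Prop 3.6(iii) p.38] -/
def lift : Γ →* S.limit where
  toFun g := ⟨fun i => π i g, fun _ _ h => hπ h g⟩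
  map_one' := Subtype.ext (funext fun i => map_one (π i))
  map_mul' g g' := Subtype.ext (funext fun i => map_mul (π i) g g')

/-- The universal homomorphism followed by a projection is the given component. [cite: MochizukiSemiAnbd2006, Prop 3.6(iii) p.38] -/
@[simp] theorem proj_lift (i : S.ι) (g : Γ) : S.proj i (S.lift π hπ g) = π i g := rfl

/-- As homomorphisms: `proj i ∘ lift = π i`. [cite: MochizukiSemiAnbd2006, Prop 3.6(iii) p.38] -/
theorem proj_comp_lift (i : S.ι) : (S.proj i).comp (S.lift π hπ) = π i := rfl

/-- The kernel of the universal homomorphism is the intersection of the `ker π_i`. [cite: MochizukiSemiAnbd2006, Prop 3.6(iii) p.38] -/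
theorem lift_eq_one_iff (g : Γ) : S.lift π hπ g = 1 ↔ ∀ i, π i g = 1 := by
  constructor
  · intro h i
    have := congrArg (fun x : S.limit => S.proj i x) h
    simpa only [proj_lift, map_one] using this
  · intro h
    exact Subtype.ext (funext fun i => h i)

/-- **Injectivity** of `Γ → lim_i S.obj i` ⟺ the kernels `ker π_i` meet in `1` (print: "`π₁^temp(G) ↪ π̂₁(G)`",
residual finiteness with respect to the levels, Prop. 3.6 (iii)). [cite: MochizukiSemiAnbd2006, Prop 3.6(iii) p.38] -/
theorem lift_injective (hsep : ∀ g : Γ, (∀ i, π i g = 1) → g = 1) : Function.Injective (S.lift π hπ) := by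
  rw [← MonoidHom.ker_eq_bot_iff, Subgroup.eq_bot_iff_forall]
  intro g hg
  exact hsep g ((S.lift_eq_one_iff π hπ g).mp hg)

/-- The universal homomorphism is continuous when every `π_i` is (e.g. when every `ker π_i` is open).
[cite: MochizukiSemiAnbd2006, Prop 3.6(iii) p.38] -/
theorem continuous_lift [TopologicalSpace Γ] (hc : ∀ i, Continuous (π i)) : Continuous (S.lift π hπ) :=
  Continuous.subtype_mk (continuous_pi fun i => hc i) _

/-- A homomorphism from a topological group to a discrete group is continuous as soon as its kernel is open.
[cite: MochizukiSemiAnbd2006, Prop 3.6(iii) p.38] -/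
theorem continuous_of_isOpen_ker [TopologicalSpace Γ] [IsTopologicalGroup Γ] (i : S.ι)
    (hopen : IsOpen ((π i).ker : Set Γ)) : Continuous (π i) := by
  refine continuous_def.mpr fun U _ => ?_
  -- the preimage of `U` is a union of cosets of the open kernel
  have h : (π i) ⁻¹' U = ⋃ g ∈ (π i) ⁻¹' U, (fun k => g * k) '' ((π i).ker : Set Γ) := by
    ext x
    simp only [Set.mem_preimage, Set.mem_iUnion, Set.mem_image, SetLike.mem_coe, MonoidHom.mem_ker]
    constructor
    · intro hx
      exact ⟨x, hx, 1, map_one _, mul_one x⟩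
    · rintro ⟨g, hg, k, hk, rfl⟩
      rwa [map_mul, hk, mul_one]
  rw [h]
  exact isOpen_biUnion fun g _ => (Homeomorph.mulLeft g).isOpenMap _ hopen

end Lift

end CountableDiscreteSystem

end Literature.AnabelianGeometry.SemiGraphs
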